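/-
Copyright (c) 2026 the pub-hodgecm-mathlib formalisation cell (harness21).  Prover seat hodgecm-mathlib-LH4-p14 (g0), req620 Track A «(D-RAM) FOUR-FRAME» squad
(heir LEAD F0P3a-plan (g19) (R-17) «NI2 ⊕ MS»; dealer LH4-plan (g10) WORD #38 (2); MS ROAD-A brick of LH4-p10 (g0) 22:29:29Z (B), first seat of (MS)).  2026-09-03.
-/
import Literature.NumberTheory.Automorphic.UnitaryLatticeTreeDual   -- ★ `dualLatt_latt_eq` (`(latt A)^♯ = latt(((σA)ᵀ·H)⁻¹)`); brings ★ `UnitaryLatticeTreeDefs` (`latt`, `dualLatt`)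
import HarnessLib

/-!
# Crux `H413`, line LH4 «(D-RAM) FOUR-FRAME» road — unit U3_Laws (iii), (R-17) MS ROAD A, TIER 2 SUPPORT: «HNF DUAL FRAME» — the dual lattice of an HNF lattice for the diagonal
# form `diag(d)` is the lattice of the explicit upper-triangular frame `((σV)ᵀ·diag d)⁻¹`

Cell `hodgecm-mathlib` (D-0151), FLOOR 0, crux item H413 = `stmt-HodgeConjecture-24833`, route of record `HCCMUnconditional`; squad F0∕P3c∕LH4 (req618∕req620).  THEOREMS ONLY
(no `def`, no instance, no notation, no `sorry`, default heartbeats); lane `--supports stmt-HodgeConjecture-24833 --as helper` (count-neutral).  MS ROAD-A brick «HNF DUAL FRAME»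
of LH4-p10 (g0)'s (S-fin) reduction (MEMO `F0/P3c/LH4/LH4-p10/g0/MEMO-stableLaw-finite.v1.LH4p10g0.md` §3 «Dualisability: `pr_i(M^♯) = 𝔭^{m_i}` from the rows of `W = σ̃(V)^{−T}`»),
statement BY SIGNATURE as worded on the squad bus 2026-09-03T22:29:29Z (B).

WHAT IS PROVED (generic valued field `K`, valuation-preserving `σ`, `ϖ ≠ 0`, `d_i ≠ 0`).  For the column-HNF frame `V = (1 0 0; x ϖ^b 0; y z ϖ^c)` of (S-fin) and the diagonal
form `h_d = diag(d)`:  `(latt V)^♯ = latt U` with the explicit upper-triangular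
`U = ((σV)ᵀ·diag d)⁻¹ = (d₀⁻¹, −σx(σϖ^b)⁻¹d₀⁻¹, (σxσz(σϖ^b)⁻¹ − σy)(σϖ^c)⁻¹d₀⁻¹; 0, (σϖ^b)⁻¹d₁⁻¹, −σz(σϖ^b)⁻¹(σϖ^c)⁻¹d₁⁻¹; 0, 0, (σϖ^c)⁻¹d₂⁻¹)` — ★ `dualLatt_latt_eq`
(`(latt A)^♯ = latt(((σA)ᵀH)⁻¹)`, [Jacobowitz1962, §4]) and the inverse computed entry by entry (`((σV)ᵀ·diag d)·U = 1`).  The columns of `U` are the dual basis; its rows give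
the dualisability exponents `pr_i(M^♯)` of the (S-fin) count.
* `det_hnf`, `isUnit_det_hnf` — `det V = ϖ^{b+c}`.
* `transpose_map_hnf_mul_diagonal_mul_eq_one` — `((σV)ᵀ·diag d)·U = 1`.
* `inv_transpose_map_hnf_mul_diagonal` — `((σV)ᵀ·diag d)⁻¹ = U`.
* **`dualLatt_diagonal_latt_hnf`** — the brick verbatim.
HONEST LABEL.  Count-neutral; nothing printed is asserted; the census laws stay PROVER TARGETS; `HC_CM` is proved only modulo the 7 printed citations (2 remaining named inputs:
hLiu418 = `stmt-HodgeConjecture-24832`, h413 = `stmt-HodgeConjecture-24833`) until rung 0 closes.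

## References
* [Jacobowitz1962] R. Jacobowitz, *Hermitian forms over local fields*, Amer. J. Math. 84 (1962), §4 (dual lattice of a free lattice: the dual basis).
* [Serre1980Trees] J.-P. Serre, *Trees*, Springer (1980), Ch. II §1.1 (lattices `g·𝒪^N`, Hermite normal form).
* [BruhatTits1972] F. Bruhat, J. Tits, *Groupes réductifs sur un corps local I*, Publ. Math. IHÉS 41 (1972), §10.
-/

set_option autoImplicit false

noncomputable section

namespace Summit.HodgeConjecture.HodgeConjecture.Cruxes.H413.F0P3cDyRamDiagonalHNFDual

open Matrix
open Literature.NumberTheory.Automorphic Literature.NumberTheory.Automorphic.HermitianLattice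
open Literature.NumberTheory.Automorphic.UnitaryLatticeTree
open scoped Valued WithZero Matrix MatrixGroups

variable {K : Type*} [Field K]

/-- `det (1 0 0; x ϖ^b 0; y z ϖ^c) = ϖ^b·ϖ^c` (lower triangular). [cite: Serre1980Trees, II §1.1] -/
theorem det_hnf (ϖ x y z : K) (b c : ℕ) : (!![1, 0, 0; x, ϖ ^ b, 0; y, z, ϖ ^ c] : Matrix (Fin 3) (Fin 3) K).det = ϖ ^ b * ϖ ^ c := by
  rw [Matrix.det_fin_three]
  simp

/-- The HNF frame is invertible (`ϖ ≠ 0`). [cite: Serre1980Trees, II §1.1] -/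
theorem isUnit_det_hnf {ϖ : K} (hϖ : ϖ ≠ 0) (x y z : K) (b c : ℕ) : IsUnit (!![1, 0, 0; x, ϖ ^ b, 0; y, z, ϖ ^ c] : Matrix (Fin 3) (Fin 3) K).det := by
  rw [det_hnf]
  exact (mul_ne_zero (pow_ne_zero _ hϖ) (pow_ne_zero _ hϖ)).isUnit

/-- **`((σV)ᵀ·diag d)·U = 1`** for the explicit upper-triangular `U` of the brick (nine entries). [cite: Jacobowitz1962, §4] -/
theorem transpose_map_hnf_mul_diagonal_mul_eq_one (σ : K →+* K) {ϖ : K} (hϖ : ϖ ≠ 0) {d : Fin 3 → K} (hd : ∀ i, d i ≠ 0) (x y z : K) (b c : ℕ) :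
    ((!![1, 0, 0; x, ϖ ^ b, 0; y, z, ϖ ^ c] : Matrix (Fin 3) (Fin 3) K).map σ)ᵀ * Matrix.diagonal d *
        !![(d 0)⁻¹, -σ x * (σ ϖ ^ b)⁻¹ * (d 0)⁻¹, (σ x * σ z * (σ ϖ ^ b)⁻¹ - σ y) * (σ ϖ ^ c)⁻¹ * (d 0)⁻¹;
           0, (σ ϖ ^ b)⁻¹ * (d 1)⁻¹, -σ z * (σ ϖ ^ b)⁻¹ * (σ ϖ ^ c)⁻¹ * (d 1)⁻¹;
           0, 0, (σ ϖ ^ c)⁻¹ * (d 2)⁻¹] = 1 := by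
  have hσϖ : σ ϖ ≠ 0 := (map_ne_zero σ).2 hϖ
  have hb : (σ ϖ ^ b : K) ≠ 0 := pow_ne_zero _ hσϖ
  have hc : (σ ϖ ^ c : K) ≠ 0 := pow_ne_zero _ hσϖ
  have h0 := hd 0
  have h1 := hd 1
  have h2 := hd 2
  have hdiag : Matrix.diagonal d = !![d 0, 0, 0; 0, d 1, 0; 0, 0, d 2] := by
    ext i j
    fin_cases i <;> fin_cases j <;> simp
  rw [hdiag]
  ext i j
  fin_cases i <;> fin_cases j <;> simp [Matrix.mul_apply, Fin.sum_univ_three, map_pow] <;> field_simp <;> ring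

/-- **`((σV)ᵀ·diag d)⁻¹ = U`.** [cite: Jacobowitz1962, §4] -/
theorem inv_transpose_map_hnf_mul_diagonal (σ : K →+* K) {ϖ : K} (hϖ : ϖ ≠ 0) {d : Fin 3 → K} (hd : ∀ i, d i ≠ 0) (x y z : K) (b c : ℕ) :
    (((!![1, 0, 0; x, ϖ ^ b, 0; y, z, ϖ ^ c] : Matrix (Fin 3) (Fin 3) K).map σ)ᵀ * Matrix.diagonal d)⁻¹ =
      !![(d 0)⁻¹, -σ x * (σ ϖ ^ b)⁻¹ * (d 0)⁻¹, (σ x * σ z * (σ ϖ ^ b)⁻¹ - σ y) * (σ ϖ ^ c)⁻¹ * (d 0)⁻¹;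
         0, (σ ϖ ^ b)⁻¹ * (d 1)⁻¹, -σ z * (σ ϖ ^ b)⁻¹ * (σ ϖ ^ c)⁻¹ * (d 1)⁻¹;
         0, 0, (σ ϖ ^ c)⁻¹ * (d 2)⁻¹] :=
  Matrix.inv_eq_right_inv (transpose_map_hnf_mul_diagonal_mul_eq_one σ hϖ hd x y z b c)

variable [Valued K ℤᵐ⁰]

/-- **«HNF DUAL FRAME» (MS ROAD-A brick).**  For `σ` valuation-preserving, `ϖ ≠ 0`, `d_i ≠ 0`: the `diag(d)`-dual of the HNF lattice `latt (1 0 0; x ϖ^b 0; y z ϖ^c)` is the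
lattice of the explicit upper-triangular frame `U = ((σV)ᵀ·diag d)⁻¹` (★ `dualLatt_latt_eq` + the entrywise inverse).  Its columns are the dual basis of the columns of `V`; the rows
give `pr_i(M^♯)`, the dualisability exponents of the (S-fin) count. [cite: Jacobowitz1962, §4] [cite: Serre1980Trees, II §1.1] [cite: BruhatTits1972, §10] -/
theorem dualLatt_diagonal_latt_hnf {K : Type*} [Field K] [Valued K ℤᵐ⁰] (σ : K →+* K) (hvσ : ∀ a, Valued.v (σ a) = Valued.v a) {ϖ : K} (hϖ : ϖ ≠ 0)
    {d : Fin 3 → K} (hd : ∀ i, d i ≠ 0) (x y z : K) (b c : ℕ) :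
    dualLatt σ (Matrix.diagonal d) (latt (!![1, 0, 0; x, ϖ ^ b, 0; y, z, ϖ ^ c] : Matrix (Fin 3) (Fin 3) K)) =
      latt (!![(d 0)⁻¹, -σ x * (σ ϖ ^ b)⁻¹ * (d 0)⁻¹, (σ x * σ z * (σ ϖ ^ b)⁻¹ - σ y) * (σ ϖ ^ c)⁻¹ * (d 0)⁻¹;
              0, (σ ϖ ^ b)⁻¹ * (d 1)⁻¹, -σ z * (σ ϖ ^ b)⁻¹ * (σ ϖ ^ c)⁻¹ * (d 1)⁻¹;
              0, 0, (σ ϖ ^ c)⁻¹ * (d 2)⁻¹] : Matrix (Fin 3) (Fin 3) K) := by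
  have hH : IsUnit (Matrix.diagonal d).det := by
    rw [Matrix.det_diagonal]
    exact (Finset.prod_ne_zero_iff.2 fun i _ => hd i).isUnit
  rw [dualLatt_latt_eq σ hvσ hH (isUnit_det_hnf hϖ x y z b c), inv_transpose_map_hnf_mul_diagonal σ hϖ hd x y z b c]

end Summit.HodgeConjecture.HodgeConjecture.Cruxes.H413.F0P3cDyRamDiagonalHNFDual

end
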